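import Summits.HodgeConjecture.CorCM.Census.BaseBlockCovering

/-!
# Voronoi star reduction: inside the strict Voronoi cell of a base change, every type reduces EXPLICITLY to the star form

COR-CM (cell `pub-hodgecm2`), count-neutral kernel combinatorics by the binder seat b09 (gen 38; lane TWO-ADIC SPLITTING +
NONDEGENERATE REDUCTION, part E), sequel of part C `Census/BaseBlockCovering.lean` (`bpot`, `exists_choice`, `bpot_corners_lt`,
`par_cover_self/other`) on the generic engines of `Census/TwistGenerationDescent.lean` (`descent`, `single_sub_thetaG_mem_of`,
`thetaG_typeSum_single`) used BY NAME.  One bookkeeping definition with body (`vcell`, the strict Voronoi cell of a base change) + theorems;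
no `decide`, no certificate, no named fact, no `sorry`.
HONEST FRAMING: `HC_CM` is NOT proved, here or anywhere in the tree; nothing here is a period or a headline.

WHY.  Part C covers every block of potential `≥ 2` by one face and descends every vector to the RESIDUAL types, but the descent is not explicit:
a closing argument (part A/D: reduce the residual types onto `ℤ[G]·[T₀]` up to `2^k`) must know HOW the corners of its closing faces reduce.
The twist columns answered this with near classes / upper classes of the centres `cst a`; this file answers it for an ARBITRARY base type `T₀`:

* §1 **The strict Voronoi cell** `vcell T₀ Q = {Φ | ddist (T₀·Q⁻¹) Φ < ddist (T₀·Q'⁻¹) Φ for every other base change T₀·Q'⁻¹ ≠ T₀·Q⁻¹}` — the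
  types with a UNIQUE nearest base change.  On it the potential is the distance to `T₀·Q⁻¹` (`bpot_eq_of_mem_vcell`), every minimiser IS
  `T₀·Q⁻¹` (`rt_eq_of_mem_vcell`), and the cell is CLOSED UNDER FLIPS TOWARD ITS CENTRE (`oflipCM_mem_vcell`: a flip changes every deviation
  distance by exactly one, `TwistGeneration.ddist_le_ddist_oflipCM_add_one`).
* §2 **COVERING TOWARD MINIMISERS** (`exists_cover_toward`): the covering family of part C, re-exported with the property a closing needs —
  modulo any `L ⊇ ℤ⟨base changes of S⟩`, through EVERY type `Φ` of potential `≥ 2` there is a face of `L` at two deviation places from a NEAREST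
  base change (`toward` property); one face per block of potential `≥ 2`, parity-independent with the pivot profile of part C.
* §3 **CONSEQUENCES of the `toward` property** for a lattice `L`: the descent to the residual types (`descent_of_toward`) and
  **THE VORONOI STAR FORM** (`star_of_toward`): for every `Q` and every `Φ ∈ vcell T₀ Q`,
  `[Φ] ≡ θ_{T₀·Q⁻¹}(typeSum [Φ]) = Σ_{t ∈ T₀·Q⁻¹ ∖ Φ} [ (T₀·Q⁻¹)^{(t)} ] − (|T₀·Q⁻¹ ∖ Φ| − 1)·[T₀·Q⁻¹]  (mod L)` —
  an EXPLICIT combination of the centre and its single flips.  In particular, when the base changes of `T₀` are pairwise at Hamming distance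
  `≥ 2ρ + 1`, every type within distance `ρ` of a base change reduces explicitly (the corners of closing faces at residual types have distance
  `≤ 3`).

## References
* [Pohlmann1968] H. Pohlmann, Algebraic cycles on abelian varieties of complex multiplication type, Ann. of Math. 88 (1968), Thm 1.
-/

namespace Summit.HodgeConjecture.CorCM.Census.BaseBlock

open Finset
open Summit.HodgeConjecture.CorCM.Prior.AllgGroup.RfwfAllgGroup
open Summit.HodgeConjecture.CorCM.Census.BlockParity
open Summit.HodgeConjecture.CorCM.Census.Coinvariant
open Summit.HodgeConjecture.CorCM.Census.TwistGeneration

noncomputable section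

variable {G : Type*} [Group G] [Fintype G] [DecidableEq G] (c : G) (T₀ : CMF G c)

/-! ## §1 The strict Voronoi cell of a base change -/

/-- **The strict Voronoi cell** of the base change `T₀·Q⁻¹`: the types strictly nearer to it than to every other base change of `T₀`.
[folklore] -/
def vcell (Q : G) : Set (CMF G c) :=
  {Φ | ∀ Q' : G, rt c Q' T₀ ≠ rt c Q T₀ → ddist (rt c Q T₀) Φ < ddist (rt c Q' T₀) Φ}

/-- Membership in the strict Voronoi cell. [folklore] -/
theorem mem_vcell_iff (Q : G) (Φ : CMF G c) :
    Φ ∈ vcell c T₀ Q ↔ ∀ Q' : G, rt c Q' T₀ ≠ rt c Q T₀ → ddist (rt c Q T₀) Φ < ddist (rt c Q' T₀) Φ := Iff.rfl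

/-- **In the cell the centre is the unique minimiser**: any base change realising the potential IS the centre. [folklore] -/
theorem rt_eq_of_mem_vcell {Q : G} {Φ : CMF G c} (hΦ : Φ ∈ vcell c T₀ Q) {Q' : G} (hQ' : bpot c T₀ Φ = ddist (rt c Q' T₀) Φ) :
    rt c Q' T₀ = rt c Q T₀ := by
  by_contra hne
  have h1 := hΦ Q' hne
  have h2 := bpot_le c T₀ Φ Q
  omega

/-- In the cell the potential is the distance to the centre. [folklore] -/
theorem bpot_eq_of_mem_vcell {Q : G} {Φ : CMF G c} (hΦ : Φ ∈ vcell c T₀ Q) : bpot c T₀ Φ = ddist (rt c Q T₀) Φ := by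
  obtain ⟨Q', hQ'⟩ := exists_bpot_eq c T₀ Φ
  rw [hQ', rt_eq_of_mem_vcell c T₀ hΦ hQ']

/-- The centre lies in its own cell. [folklore] -/
theorem rt_mem_vcell (Q : G) : rt c Q T₀ ∈ vcell c T₀ Q := by
  intro Q' hQ'
  rw [ddist_self]
  refine Nat.pos_of_ne_zero fun h0 => hQ' ?_
  rw [ddist, Finset.card_eq_zero] at h0
  exact (eq_of_dev_empty c h0).symm

/-- **The cell is closed under flips toward its centre.** [folklore] -/
theorem oflipCM_mem_vcell (hc2 : c * c = 1) {Q : G} {Φ : CMF G c} (hΦ : Φ ∈ vcell c T₀ Q) {t : G}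
    (ht : t ∈ (rt c Q T₀).1 \ Φ.1) : oflipCM c hc2 t Φ ∈ vcell c T₀ Q := by
  intro Q' hQ'
  have h1 := hΦ Q' hQ'
  have h2 := ddist_oflipCM_of_mem_sdiff hc2 ht
  have h3 := ddist_le_ddist_oflipCM_add_one hc2 (rt c Q' T₀) Φ t
  omega

/-- The cell is closed under the double flip at two distinct deviation places. [folklore] -/
theorem oflipCM_oflipCM_mem_vcell (hc2 : c * c = 1) {Q : G} {Φ : CMF G c} (hΦ : Φ ∈ vcell c T₀ Q) {t t' : G}
    (ht : t ∈ (rt c Q T₀).1 \ Φ.1) (ht' : t' ∈ (rt c Q T₀).1 \ Φ.1) (htt' : t ≠ t') :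
    oflipCM c hc2 t (oflipCM c hc2 t' Φ) ∈ vcell c T₀ Q := by
  refine oflipCM_mem_vcell c T₀ hc2 (oflipCM_mem_vcell c T₀ hc2 hΦ ht') ?_
  rw [dev_oflip c hc2 (mem_sdiff.mp ht').1 (mem_sdiff.mp ht').2]
  exact mem_erase.mpr ⟨htt', ht⟩

/-! ## §2 Covering toward minimisers -/

/-- **THE COVERING FAMILY, `toward` form**: EXACTLY one face per block of potential `≥ 2`, parity-independent with the pivot profile of part C, and
modulo any lattice containing its base changes a face at two deviation places from a NEAREST base change through EVERY type of potential `≥ 2`.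
[folklore] -/
theorem exists_cover_toward (hc2 : c * c = 1) :
    ∃ S : Finset (CMF G c →₀ ℤ), (↑S ⊆ gfaceSet G c hc2) ∧
      S.card = (univ.filter fun Bk : Block c => 2 ≤ bpot c T₀ Bk.out).card ∧
      LinearIndepOn (ZMod 2) (fun f : CMF G c →₀ ℤ => par c f) ↑S ∧
      (∀ f ∈ S, ∃ Ψ : CMF G c, 2 ≤ bpot c T₀ Ψ ∧ par c f (blk c Ψ) = 1 ∧
        ∀ B : Block c, B ≠ blk c Ψ → bpot c T₀ Ψ ≤ bpot c T₀ B.out → par c f B = 0) ∧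
      ∀ L : Submodule ℤ (CMF G c →₀ ℤ), Submodule.span ℤ (translates c S) ≤ L →
        ∀ Φ : CMF G c, 2 ≤ bpot c T₀ Φ → ∃ Q t t' : G, bpot c T₀ Φ = ddist (rt c Q T₀) Φ ∧
          t ∈ (rt c Q T₀).1 \ Φ.1 ∧ t' ∈ (rt c Q T₀).1 \ Φ.1 ∧ t ≠ t' ∧ gface c hc2 Φ t t' ∈ L := by
  classical
  have hch : ∀ Bk : Block c, ∃ τ : G × G × G, 2 ≤ bpot c T₀ Bk.out →
      bpot c T₀ Bk.out = ddist (rt c τ.1 T₀) Bk.out ∧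
        τ.2.1 ∈ (rt c τ.1 T₀).1 \ Bk.out.1 ∧ τ.2.2 ∈ (rt c τ.1 T₀).1 \ Bk.out.1 ∧ τ.2.1 ≠ τ.2.2 := by
    intro Bk
    by_cases h : 2 ≤ bpot c T₀ Bk.out
    · obtain ⟨Q, t, t', h1, h3, h4, h5⟩ := exists_choice c T₀ Bk.out h
      exact ⟨(Q, t, t'), fun _ => ⟨h1, h3, h4, h5⟩⟩
    · exact ⟨(1, 1, 1), fun h' => absurd h' h⟩
  choose τ hτ using hch
  set NI : Finset (Block c) := univ.filter fun Bk : Block c => 2 ≤ bpot c T₀ Bk.out with hNI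
  set face : Block c → (CMF G c →₀ ℤ) := fun Bk => gface c hc2 Bk.out (τ Bk).2.1 (τ Bk).2.2 with hfaceDef
  set S : Finset (CMF G c →₀ ℤ) := NI.image face with hS
  have hself : ∀ Bk ∈ NI, par c (face Bk) Bk = 1 := by
    intro Bk hBk
    obtain ⟨h1, h3, h4, h5⟩ := hτ Bk (mem_filter.mp hBk).2
    have h := par_cover_self c T₀ hc2 h1 h3 h4 h5
    rwa [blk_out] at h
  have hother : ∀ Bk ∈ NI, ∀ B : Block c, B ≠ Bk → bpot c T₀ Bk.out ≤ bpot c T₀ B.out → par c (face Bk) B = 0 := by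
    intro Bk hBk B hB hle
    obtain ⟨h1, h3, h4, h5⟩ := hτ Bk (mem_filter.mp hBk).2
    exact par_cover_other c T₀ hc2 h1 h3 h4 h5 (by rw [blk_out]; exact hB) hle
  have hinj : Set.InjOn face ↑NI := by
    intro B₁ hB₁ B₂ hB₂ heq
    by_contra hne
    rcases le_total (bpot c T₀ B₁.out) (bpot c T₀ B₂.out) with hle | hle
    · have h0 := hother B₁ hB₁ B₂ (Ne.symm hne) hle
      rw [heq, hself B₂ hB₂] at h0
      exact one_ne_zero h0
    · have h0 := hother B₂ hB₂ B₁ hne hle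
      rw [← heq, hself B₁ hB₁] at h0
      exact one_ne_zero h0
  have hSsub : (↑S : Set (CMF G c →₀ ℤ)) ⊆ gfaceSet G c hc2 := by
    intro y hy
    obtain ⟨Bk, hBk, rfl⟩ := mem_image.mp (mem_coe.mp hy)
    obtain ⟨-, h3, h4, h5⟩ := hτ Bk (mem_filter.mp hBk).2
    exact ⟨Bk.out, _, _, not_mem_orb_of_mem (mem_sdiff.mp h3).1 (mem_sdiff.mp h4).1 h5, rfl⟩
  refine ⟨S, hSsub, card_image_of_injOn hinj, ?_, ?_, fun L hL Φ hΦ2 => ?_⟩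
  · -- parity independence (pivot = own block, rank = potential)
    set p : (CMF G c →₀ ℤ) → Block c := fun f => if h : ∃ Bk ∈ NI, face Bk = f then h.choose else blk c T₀ with hp
    have hpf : ∀ Bk ∈ NI, p (face Bk) = Bk := by
      intro Bk hBk
      have h : ∃ B ∈ NI, face B = face Bk := ⟨Bk, hBk, rfl⟩
      rw [hp]; simp only [dif_pos h]
      exact hinj h.choose_spec.1 hBk h.choose_spec.2
    rw [LinearIndepOn, linearIndependent_iff']
    intro t g hsum i₁ hi₁
    by_contra hgi₁
    obtain ⟨i₀, hi₀, hmax⟩ := Finset.exists_max_image (t.filter fun i => g i ≠ 0) (fun i => bpot c T₀ (p i.1).out)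
      ⟨i₁, mem_filter.mpr ⟨hi₁, hgi₁⟩⟩
    obtain ⟨hi₀t, hgi₀⟩ := mem_filter.mp hi₀
    obtain ⟨B₀, hB₀, hfB₀⟩ := mem_image.mp i₀.2
    have hp₀ : p i₀.1 = B₀ := by rw [← hfB₀]; exact hpf B₀ hB₀
    have heval := congrFun hsum B₀
    rw [Finset.sum_apply, Pi.zero_apply, Finset.sum_eq_single_of_mem i₀ hi₀t] at heval
    · rw [Pi.smul_apply, smul_eq_mul, ← hfB₀, hself B₀ hB₀, mul_one] at heval
      exact hgi₀ heval
    · intro j hjt hji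
      rw [Pi.smul_apply, smul_eq_mul]
      by_cases hgj : g j = 0
      · rw [hgj, zero_mul]
      · obtain ⟨Bj, hBj, hfBj⟩ := mem_image.mp j.2
        have hpj : p j.1 = Bj := by rw [← hfBj]; exact hpf Bj hBj
        have hlj : bpot c T₀ Bj.out ≤ bpot c T₀ B₀.out := by
          have h := hmax j (mem_filter.mpr ⟨hjt, hgj⟩)
          rwa [hpj, hp₀] at h
        have hne : B₀ ≠ Bj := fun e => hji (Subtype.ext (by rw [← hfBj, ← hfB₀, e]))
        rw [← hfBj, hother Bj hBj B₀ hne hlj, mul_zero]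
  · intro f hf
    obtain ⟨Bk, hBk, rfl⟩ := mem_image.mp hf
    refine ⟨Bk.out, (mem_filter.mp hBk).2, ?_, fun B hB hle => hother Bk hBk B ?_ hle⟩
    · rw [blk_out]; exact hself Bk hBk
    · rw [blk_out] at hB; exact hB
  · -- the translated block face through `Φ` is a face toward a nearest base change
    obtain ⟨Q, hQ⟩ := exists_rt_eq_of_blk_eq c (Quotient.out_eq (blk c Φ) : blk c (blk c Φ).out = blk c Φ)
    have hBNI : blk c Φ ∈ NI := mem_filter.mpr ⟨mem_univ _, by rw [bpot_out]; exact hΦ2⟩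
    obtain ⟨h1, h3, h4, h5⟩ := hτ (blk c Φ) (mem_filter.mp hBNI).2
    set R := (τ (blk c Φ)).1
    set t := (τ (blk c Φ)).2.1
    set t' := (τ (blk c Φ)).2.2
    have hmem : gface c hc2 Φ (t * Q⁻¹) (t' * Q⁻¹) ∈ L := by
      have e : gface c hc2 Φ (t * Q⁻¹) (t' * Q⁻¹) = Finsupp.mapDomain (rt c Q) (face (blk c Φ)) := by
        rw [mapDomain_rt_gface, hQ]
      rw [e]
      exact hL (Submodule.subset_span ⟨Q, _, mem_image_of_mem _ hBNI, rfl⟩)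
    have hQ' : bpot c T₀ Φ = ddist (rt c (Q * R) T₀) Φ := by
      rw [← hQ, bpot_rt, rt_mul, ddist_rt]; exact h1
    have hs : t * Q⁻¹ ∈ (rt c (Q * R) T₀).1 \ Φ.1 := by
      rw [rt_mul, ← hQ, mem_sdiff_rt_iff, inv_mul_cancel_right]; exact h3
    have hs' : t' * Q⁻¹ ∈ (rt c (Q * R) T₀).1 \ Φ.1 := by
      rw [rt_mul, ← hQ, mem_sdiff_rt_iff, inv_mul_cancel_right]; exact h4
    have hss' : t * Q⁻¹ ≠ t' * Q⁻¹ := fun h => h5 (mul_right_cancel h)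
    exact ⟨Q * R, t * Q⁻¹, t' * Q⁻¹, hQ', hs, hs', hss', hmem⟩

/-! ## §3 Consequences of the `toward` property: descent and the Voronoi star form -/

/-- **Descent from the `toward` property.**  If `L` holds a face toward a nearest base change through every type of potential `≥ 2`, every vector
is congruent modulo `L` to one supported on residual types. [folklore] -/
theorem descent_of_toward (hc2 : c * c = 1) (L : Submodule ℤ (CMF G c →₀ ℤ))
    (hL : ∀ Φ : CMF G c, 2 ≤ bpot c T₀ Φ → ∃ Q t t' : G, bpot c T₀ Φ = ddist (rt c Q T₀) Φ ∧
      t ∈ (rt c Q T₀).1 \ Φ.1 ∧ t' ∈ (rt c Q T₀).1 \ Φ.1 ∧ t ≠ t' ∧ gface c hc2 Φ t t' ∈ L)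
    (y : CMF G c →₀ ℤ) : ∃ y' : CMF G c →₀ ℤ, y - y' ∈ L ∧ ∀ Ψ ∈ y'.support, bpot c T₀ Ψ ≤ 1 := by
  refine descent c (bpot c T₀) (fun Ψ => bpot c T₀ Ψ ≤ 1) hc2 L (fun Ψ hΨ => ?_) y
  obtain ⟨Q, t, t', hQ, ht, ht', htt', hmem⟩ := hL Ψ (by omega)
  exact ⟨t, t', hmem, bpot_corners_lt c T₀ hc2 hQ ht ht' htt'⟩

/-- **THE VORONOI STAR FORM.**  If `L` holds a face toward a nearest base change through every type of potential `≥ 2`, then for every `Q` and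
every `Φ` in the strict Voronoi cell of `T₀·Q⁻¹`:  `[Φ] − θ_{T₀·Q⁻¹}(typeSum [Φ]) ∈ L`, i.e.
`[Φ] ≡ Σ_{t ∈ T₀·Q⁻¹ ∖ Φ} [(T₀·Q⁻¹)^{(t)}] − (|T₀·Q⁻¹ ∖ Φ| − 1)·[T₀·Q⁻¹]` (`TwistGeneration.thetaG_typeSum_single`). [folklore] -/
theorem star_of_toward (hc2 : c * c = 1) (L : Submodule ℤ (CMF G c →₀ ℤ))
    (hL : ∀ Φ : CMF G c, 2 ≤ bpot c T₀ Φ → ∃ Q t t' : G, bpot c T₀ Φ = ddist (rt c Q T₀) Φ ∧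
      t ∈ (rt c Q T₀).1 \ Φ.1 ∧ t' ∈ (rt c Q T₀).1 \ Φ.1 ∧ t ≠ t' ∧ gface c hc2 Φ t t' ∈ L)
    (Q : G) : ∀ Φ : CMF G c, Φ ∈ vcell c T₀ Q →
      Finsupp.single Φ 1 - thetaG c hc2 (rt c Q T₀) (typeSum G c (Finsupp.single Φ 1)) ∈ L := by
  refine single_sub_thetaG_mem_of c (rt c Q T₀) (fun Φ => Φ ∈ vcell c T₀ Q) hc2 L (fun Φ hΦ hdev => ?_)
  have hΦ2 : 2 ≤ bpot c T₀ Φ := by rw [bpot_eq_of_mem_vcell c T₀ hΦ, ddist]; exact hdev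
  obtain ⟨Q', t, t', hQ', ht, ht', htt', hmem⟩ := hL Φ hΦ2
  have hN : rt c Q' T₀ = rt c Q T₀ := rt_eq_of_mem_vcell c T₀ hΦ hQ'
  rw [hN] at ht ht'
  exact ⟨t, t', ht, ht', htt', hmem, oflipCM_mem_vcell c T₀ hc2 hΦ ht, oflipCM_mem_vcell c T₀ hc2 hΦ ht',
    oflipCM_oflipCM_mem_vcell c T₀ hc2 hΦ ht ht' htt'⟩

/-- **Types near a base change lie in its cell when the base changes are spread out**: if every other base change is at distance `> 2·ddist`
from the centre's point of view — precisely `ddist (T₀·Q⁻¹) Φ + ddist (T₀·Q⁻¹) Φ < ddist (T₀·Q'⁻¹) (T₀·Q⁻¹)` for all `T₀·Q'⁻¹ ≠ T₀·Q⁻¹` —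
then `Φ ∈ vcell T₀ Q` (triangle inequality for the deviation distance). [folklore] -/
theorem mem_vcell_of_spread (hc2 : c * c = 1) {Q : G} {Φ : CMF G c}
    (h : ∀ Q' : G, rt c Q' T₀ ≠ rt c Q T₀ → 2 * ddist (rt c Q T₀) Φ < ddist (rt c Q' T₀) (rt c Q T₀)) :
    Φ ∈ vcell c T₀ Q := by
  intro Q' hQ'
  have htri : ddist (rt c Q' T₀) (rt c Q T₀) ≤ ddist (rt c Q' T₀) Φ + ddist (rt c Q T₀) Φ := by
    -- `T' ∖ T ⊆ (T' ∖ Φ) ∪ c·(T ∖ Φ)`-type count: a place where `T'` and `T` differ is a deviation place of `Φ` from one of them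
    unfold ddist
    have hsub : (rt c Q' T₀).1 \ (rt c Q T₀).1 ⊆ ((rt c Q' T₀).1 \ Φ.1) ∪ ((rt c Q T₀).1 \ Φ.1).image (fun x => c * x) := by
      intro x hx
      obtain ⟨hxT', hxT⟩ := mem_sdiff.mp hx
      by_cases hxΦ : x ∈ Φ.1
      · refine mem_union_right _ (mem_image.mpr ⟨c * x, mem_sdiff.mpr ⟨?_, ?_⟩, by rw [← mul_assoc, hc2, one_mul]⟩)
        · by_contra hcx
          exact hxT (((rt c Q T₀).2 x).mpr hcx)
        · exact (Φ.2 x).mp hxΦ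
      · exact mem_union_left _ (mem_sdiff.mpr ⟨hxT', hxΦ⟩)
    refine (card_le_card hsub).trans ((card_union_le _ _).trans ?_)
    have := card_image_le (s := (rt c Q T₀).1 \ Φ.1) (f := fun x => c * x)
    omega
  have h' := h Q' hQ'
  omega

end

end Summit.HodgeConjecture.CorCM.Census.BaseBlock
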